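import Mathlib
import Literature.NumberTheory.Automorphic.CongruenceSubgroupPropertySL2Holds
import Summits.Langlands.Langlands.Theorems.CapacityClassicalityHilbertIntegralOverconvergentIsCongruenceTransferCSP
import Summits.Langlands.Langlands.Theorems.CapacityClassicalityHilbertIntegralOverconvergentIsCongruenceStubTransferAbstract

/-!
# Crux `HilbertIntegralOverconvergentIsCongruence` (stmt-Langlands-8485), line `Sketch-ideate-r1-k1`:
# stub 7 (Serre's congruence subgroup property) DISCHARGED, and the transfer half made unconditional

Stub 7 of the line's skeleton (`stub_congruenceSubgroupProperty`, the one remaining `sorry` after lead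
c3) is the congruence subgroup property of `SL₂(𝓞_F)` for `F` totally real of degree `≥ 2` (Serre 1970,
Thm 2 and Cor.).  It is now a THEOREM of the tree:
`Literature.NumberTheory.Automorphic.SerreSL2Congruence1970_congruenceSubgroupProperty_holds` (p124758, the
final file of the Moore-free proof Vaserstein 1972 + Liehl 1981 + Bass–Milnor–Serre Ch. I, files
`Literature/NumberTheory/Automorphic/CongruenceSubgroupPropertySL2*.lean`).  This file

* proves the registered stub by name (`stub_congruenceSubgroupProperty`);
* discharges the hypothesis `hCSP` of the two conditional transfer theorems of the line:
  `exists_principalCongruence_fixing_of_isAlgebraic` (`…TransferCSP.lean`, p108254) becomes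
  `principalCongruence_fixing_of_isAlgebraic`, and `stub_transferAbstract` (`…StubTransferAbstract.lean`,
  p122925) becomes `transferAbstract` — the TRANSFER half of the crux modulo vocabulary is unconditional:
  for `[F:ℚ] ≥ 2`, an element `g` of any commutative domain with an `SL₂(𝓞_F)`-action by ring automorphisms
  and cocycle automorphy factors, satisfying a non-trivial polynomial relation with coefficients modular
  for a finite-index `Γ`, is fixed by some principal congruence subgroup `Γ(𝔪)`, `𝔪 ≠ 0`, under the
  weight-`k` action.
-/

set_option linter.dupNamespace false -- mandated namespace `Summit.Langlands.Langlands.…` repeats a component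

namespace Summit.Langlands.Langlands.Theorems.HilbertIntegralOverconvergentIsCongruence

open scoped NumberField

/-- **stub 7 — `stub_congruenceSubgroupProperty`** (registered signature, lead c4 RESHAPE 6): Serre's
congruence subgroup property for `SL₂(𝓞_F)`, `F` totally real of degree `≥ 2` — every finite-index
subgroup contains a principal congruence subgroup `Γ(𝔪)`, `𝔪 ≠ 0`.  Now the Literature THEOREM
`SerreSL2Congruence1970_congruenceSubgroupProperty_holds`. -/
theorem stub_congruenceSubgroupProperty :
    ∀ (F : Type) [Field F] [NumberField F] [NumberField.IsTotallyReal F],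
      1 < Module.finrank ℚ F →
      ∀ H : Subgroup (Matrix.SpecialLinearGroup (Fin 2) (NumberField.RingOfIntegers F)),
        H.FiniteIndex →
        ∃ 𝔪 : Ideal (NumberField.RingOfIntegers F), 𝔪 ≠ ⊥ ∧
          (Matrix.SpecialLinearGroup.map (Ideal.Quotient.mk 𝔪)).ker ≤ H :=
  Literature.NumberTheory.Automorphic.SerreSL2Congruence1970_congruenceSubgroupProperty_holds

/-- **Algebraic elements are fixed by a principal congruence subgroup — unconditional.**  For `F`
totally real of degree `≥ 2` and `SL₂(𝓞_F)` acting on a field `L` by `K`-algebra automorphisms, every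
`x ∈ L` algebraic over `K` is fixed by `Γ(𝔪)` for some non-zero ideal `𝔪` (orbit–stabiliser + Serre's
CSP, now a theorem). -/
theorem principalCongruence_fixing_of_isAlgebraic
    (F : Type) [Field F] [NumberField F] [NumberField.IsTotallyReal F]
    (hd : 1 < Module.finrank ℚ F) {K L : Type*} [Field K] [Field L] [Algebra K L]
    [MulSemiringAction (Matrix.SpecialLinearGroup (Fin 2) (𝓞 F)) L]
    [SMulCommClass (Matrix.SpecialLinearGroup (Fin 2) (𝓞 F)) K L] (x : L) (hx : IsAlgebraic K x) :
    ∃ 𝔪 : Ideal (𝓞 F), 𝔪 ≠ ⊥ ∧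
      ∀ γ ∈ (Matrix.SpecialLinearGroup.map (n := Fin 2) (Ideal.Quotient.mk 𝔪)).ker, γ • x = x :=
  exists_principalCongruence_fixing_of_isAlgebraic
    Literature.NumberTheory.Automorphic.SerreSL2Congruence1970_congruenceSubgroupProperty_holds F hd x hx

/-- **The TRANSFER half of the crux modulo vocabulary — unconditional** (`stub_transferAbstract` with its
hypothesis `hCSP` discharged by Serre's theorem).  `F` totally real, `[F:ℚ] ≥ 2`; `SL₂(𝓞_F)` acts on a
commutative domain `L` by ring automorphisms; `Γ` has finite index; `J : 𝓦 → SL₂(𝓞_F) → Lˣ` are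
automorphy factors, additive in the weight, with the cocycle identity.  If `F_j` (`j ≤ D`) are modular of
weight `b_j` for `Γ`, `b_j + j • k = b_0`, some `F_j ≠ 0`, and `Σ_{j≤D} F_j g^j = 0`, then some `Γ(𝔪)`,
`𝔪 ≠ 0`, fixes `g` under the weight-`k` action `γ ⋆ g = (J k γ)⁻¹ · γ • g`. -/
theorem transferAbstract
    (F : Type) [Field F] [NumberField F] [NumberField.IsTotallyReal F] (hF : 1 < Module.finrank ℚ F)
    {L 𝓦 : Type*} [CommRing L] [IsDomain L] [AddCommGroup 𝓦]
    [MulSemiringAction (Matrix.SpecialLinearGroup (Fin 2) (NumberField.RingOfIntegers F)) L]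
    (Γ : Subgroup (Matrix.SpecialLinearGroup (Fin 2) (NumberField.RingOfIntegers F))) (hΓ : Γ.FiniteIndex)
    (J : 𝓦 → Matrix.SpecialLinearGroup (Fin 2) (NumberField.RingOfIntegers F) → Lˣ)
    (hJ : ∀ (b b' : 𝓦) (γ : Matrix.SpecialLinearGroup (Fin 2) (NumberField.RingOfIntegers F)),
      J (b + b') γ = J b γ * J b' γ)
    (hJcoc : ∀ (b : 𝓦) (γ γ' : Matrix.SpecialLinearGroup (Fin 2) (NumberField.RingOfIntegers F)),
      (J b (γ * γ') : L) = J b γ * γ • (J b γ' : L))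
    (k : 𝓦) (D : ℕ) (b : ℕ → 𝓦) (hb : ∀ j ≤ D, b j + j • k = b 0)
    (Fm : ℕ → L) (hFm : ∀ j ≤ D, ∀ γ ∈ Γ, γ • Fm j = (J (b j) γ : L) * Fm j) (hFm0 : ∃ j ≤ D, Fm j ≠ 0)
    (g : L) (hrel : ∑ j ∈ Finset.range (D + 1), Fm j * g ^ j = 0) :
    ∃ 𝔪 : Ideal (NumberField.RingOfIntegers F), 𝔪 ≠ ⊥ ∧
      ∀ γ ∈ (Matrix.SpecialLinearGroup.map (Ideal.Quotient.mk 𝔪)).ker, ((J k γ)⁻¹ : Lˣ) * γ • g = g :=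
  stub_transferAbstract stub_congruenceSubgroupProperty F hF Γ hΓ J hJ hJcoc k D b hb Fm hFm hFm0 g hrel

end Summit.Langlands.Langlands.Theorems.HilbertIntegralOverconvergentIsCongruence
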